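import Summits.BirchSwinnertonDyer.BirchSwinnertonDyer.Theorems.RamifiedHeegnerPairLeafRankOneUpperAtThreeShimuraInertPrimitives
import Summits.BirchSwinnertonDyer.BirchSwinnertonDyer.Theorems.RamifiedHeegnerPairLeafRankZeroUpperAtThreeShimuraInertShaAn
import Summits.BirchSwinnertonDyer.BirchSwinnertonDyer.Theorems.ErratumRoadFiveShimuraSkolemPackageCokerTwo
import HarnessLib

/-!
# Route `RamifiedHeegnerPair`, crux U₀ `LeafRankZeroUpperAtThree` (stmt-BirchSwinnertonDyer-26024), line `splitkolyvagin0` —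
# the INERT-CARRIER (Shimura-curve) road for U₀, part 6: the core with the (DEG) identity from the FULL Papikian–Rabinoff PAIRING
# (Pasten 2024 Lemma 6.18 at `q = 2` included: `j_2 ∣ 2`), i.e. the «`q = 2` cokernel clause» rows join the Shimura rows

HONEST FRAMING. Theorems only; helper file (`--supports stmt-BirchSwinnertonDyer-26024 --as helper`); nothing is booked, no item is
closed, BSD is not proved for any curve; CONDITIONAL on every displayed input. Lead prover bsd-line-rhp-p2 g10, 2026-08-28.

WHY. Parts U0-2 … U0-5 (and U₁'s parts 2–8) asked (DEG) — `ord₃ δ(∅) = ord₃ δ(S) + Σ_{q∈S} ord₃ c_q` — through one of three printed mechanisms, the third being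
Papikian–Rabinoff at an ODD prime `q₂ ≢ 1 (mod 3)` of a PAIR `S = {q₁, q₂}` (the receptacle package
`ribetTakahashiPackageCoker_of_componentOrders` carries Lemma 6.18 for odd primes only). Cell bsd-stepL (seat er5-p1-w2) has since
exported the FULL lemma (`ribetTakahashiPackageCokerTwo_of_componentOrders`: `j_q ∣ q − 1` for odd `q`, `j_2 ∣ 2`) and the induction
`padicValNat_delta_empty_eq_of_pairingTwo`: (DEG) at an odd BSD prime for ANY even `S ⊆ Mult` with a half-size subset `R` of primes
each `= 2` or `≢ 1 (mod ℓ)`. At `ℓ = 3` this adds the rows whose only available pairing partner is `q = 2` (census, `N < 5·10⁵`: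
7 rank-one and 8 rank-zero Gss2 classes) and covers inert sets of any even size.

* `leafRankZeroUpper_three_of_shimuraInertDatum_at_pairing` — part U0-2's `leafRankZeroUpper_three_of_shimuraInertDatum_at` VERBATIM except
  the third (DEG) disjunct, now `∃ R ⊆ S, 2·#R = #S ∧ ∀ q ∈ R, q = 2 ∨ 3 ∤ q − 1`, discharged by the pairing induction.
  -- adapted from Summits/BirchSwinnertonDyer/BirchSwinnertonDyer/Theorems/RamifiedHeegnerPairLeafRankZeroUpperAtThreeShimuraInertCore.lean

References: [cite: PastenShimura2024, Prop. 6.13, Lemmas 6.14–6.16, Lemma 6.18 (p. 24), §6.9] [cite: PapikianRabinoff2016, Cor. 3.5]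
[cite: JetchevSkinnerWan2017, §7.4.2, Thm. 4.4.1] [cite: CaiShuTian2014, Thm. 1.5] [cite: McCallumLMS1991, §1 Theorem (Kolyvagin)]
[cite: Miller2011LMS, Def. 1.1].
-/


-- D-0017: single-problem summit, so `Summit.BirchSwinnertonDyer.BirchSwinnertonDyer.…` repeats a namespace BY DESIGN.
set_option linter.dupNamespace false
set_option autoImplicit false

noncomputable section

open scoped Classical NumberField

open WeierstrassCurve NumberField IsDedekindDomain Literature Literature.NumberTheory.EllipticCurves
  Rat.HeightOneSpectrum CongruenceSubgroup
  Literature.NumberTheory.EllipticCurves.ModularForms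
  Literature.NumberTheory.EllipticCurves.Rank1Residual
  Literature.NumberTheory.EllipticCurves.Rank1Residual.Typed
  Literature.NumberTheory.QuadraticFields.Quadratic
  Literature.NumberTheory.GaloisCohomology
  Literature.NumberTheory.Automorphic
  Summit.BirchSwinnertonDyer.Rank1Residual
  Summit.BirchSwinnertonDyer.Rank1Residual.Additive
  Summit.BirchSwinnertonDyer.Rank1Residual.X11b
  Summit.BirchSwinnertonDyer.Rank1Residual.X11b.Three
  Summit.BirchSwinnertonDyer.BirchSwinnertonDyer.Theses.RamifiedHeegnerPair
  Summit.BirchSwinnertonDyer.BirchSwinnertonDyer.Theorems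

namespace Summit.BirchSwinnertonDyer.BirchSwinnertonDyer.Theorems.LeafShimuraInert

/-! ## §U0.2 The U₀ core at one Jetchev–Skinner–Wan datum -/

/-- **U₀ AT A LEAF CURVE FROM ONE JETCHEV–SKINNER–WAN DATUM — core″ with the FULL Papikian–Rabinoff pairing (swapped orientation).**
Part U0-2's `leafRankZeroUpper_three_of_shimuraInertDatum_at` VERBATIM (leaf `W`, `r_an = 0`, datum with `3 ∤ c`, even inert set `S` of
multiplicative primes holding every split-multiplicative carrier, SHAPE, JSW field with `S` inert and the rest split, the twist with a
SIMPLE zero, Heegner datum asked AT THE DATUM, partner lower for the rank-one twist) except the third (DEG) disjunct: `∃ R ⊆ S` with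
`2·#R = #S` and every `q ∈ R` equal to `2` or with `3 ∤ q − 1` — discharged by `padicValNat_delta_empty_eq_of_pairingTwo` over the package
`ribetTakahashiPackageCokerTwo_of_componentOrders` (Pasten Lemma 6.18 in full: `j_2 ∣ 2`). CONCLUSION: `Typed.MissingUpperBoundAt W 3`.
CONDITIONAL; nothing booked; BSD is not proved.
-- adapted from Summits/BirchSwinnertonDyer/BirchSwinnertonDyer/Theorems/RamifiedHeegnerPairLeafRankZeroUpperAtThreeShimuraInertCore.lean
[cite: PastenShimura2024, Prop. 6.13, Lemmas 6.8, 6.14–6.16, 6.18 (pp. 22–25), §6.9] [cite: PapikianRabinoff2016, Cor. 3.5]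
[cite: JetchevSkinnerWan2017, §7.4.1–7.4.2, Thm. 4.4.1] [cite: CaiShuTian2014, Thm. 1.5] [cite: GrossZagier1986, V.§2] [cite: Miller2011LMS, Def. 1.1] -/
theorem leafRankZeroUpper_three_of_shimuraInertDatum_at_pairing
    -- published inputs (named facts of the tree)
    (hGZK : rank_eq_analyticRank_of_analyticRank_le_one) (hmod : hasEntireLFunction_rat)
    (hnf : exists_isNewformOf) (hJL : nonempty_shimuraParametrizationData)
    (hCO : PastenShimura2024_componentOrders)
    -- the leaf curve, with a datum whose constant is a `3`-unit
    (W : WeierstrassCurve ℚ) [W.IsElliptic] [W.IsGloballyMinimal]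
    (hadd : Addv W 3) (hsub : SubGss W 3) (hr : W.analyticRank = 0)
    {N : ℕ} [NeZero N] (hN : W.conductorNorm ℤ = N)
    (Dt : ModularParametrizationData W N) (hc : ¬ (3 : ℤ) ∣ Dt.c)
    -- the inert set: even, multiplicative, every split-multiplicative carrier inside
    (S : Finset ℕ) (hSeven : Even S.card)
    (hSmult : ∀ ℓ ∈ S, ∃ _ : Fact ℓ.Prime, W.HasMultiplicativeReductionAtPrime ℓ)
    (hFC : ∀ (ℓ : ℕ) [Fact ℓ.Prime], ℓ ∉ S → W.HasSplitMultiplicativeReductionAtPrime ℓ →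
      ¬ 3 ∣ padicValInt ℓ W.minimalDiscriminantInt)
    -- SHAPE: every Tamagawa-`3` carrier is split multiplicative
    (hshape : ∀ (q : ℕ) [Fact q.Prime], 3 ∣ (W.baseChange ℚ_[q]).localTamagawaNumber ℤ_[q] →
      W.HasSplitMultiplicativeReductionAtPrime q)
    -- (DEG)-availability: Pasten Lemma 6.15 | Lemma 6.16 | Lemma 6.18 in FULL (Papikian–Rabinoff PAIRING, `2` allowed)
    (hDEG : (∃ ℓ₀ ∈ S, ¬ 3 ∣ padicValInt ℓ₀ W.minimalDiscriminantInt) ∨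
      (∃ ℓ₀ t : ℕ, ∃ _ : Fact ℓ₀.Prime, ∃ _ : Fact t.Prime,
        W.HasMultiplicativeReductionAtPrime ℓ₀ ∧ W.HasMultiplicativeReductionAtPrime t ∧
        ℓ₀ ∉ S ∧ t ∉ S ∧ t ≠ ℓ₀ ∧ ¬ 3 ∣ padicValInt ℓ₀ W.minimalDiscriminantInt) ∨
      (∃ R : Finset ℕ, R ⊆ S ∧ 2 * R.card = S.card ∧ ∀ q ∈ R, q = 2 ∨ ¬ 3 ∣ q - 1))
    -- ONE Jetchev–Skinner–Wan field datum, `d_K` odd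
    (K : Type) [Field K] [NumberField K] (hK : IsImaginaryQuadratic K) (hodd : Odd (NumberField.discr K))
    (hinert : ∀ ℓ ∈ S, ((Ideal.span {(ℓ : ℤ)}).primesOver (𝓞 K)).ncard = 1 ∧ ¬ (ℓ : ℤ) ∣ NumberField.discr K)
    (hsplitN : ∀ ℓ : ℕ, ℓ.Prime → ℓ ∣ W.conductorNorm ℤ → ℓ ∉ S →
      ((Ideal.span {(ℓ : ℤ)}).primesOver (𝓞 K)).ncard = 2)
    (hLt0 : (W.quadraticTwist (NumberField.discr K : ℚ)).entireLFunction 1 = 0)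
    (hLt1 : deriv (W.quadraticTwist (NumberField.discr K : ℚ)).entireLFunction 1 ≠ 0)
    -- the Shimura-curve Heegner point, display and order bound AT THE DATUM (any source, part 8)
    (hHKat : ∀ (X : ShimuraCurveData (∏ q ∈ S, q) (N / ∏ q ∈ S, q)) (W' : WeierstrassCurve ℚ) [W'.IsElliptic]
      (P₀ : ShimuraParametrizationData X W'), P₀.IsMinimalFor W →
      ∃ (P : (W.baseChange K).toAffine.Point) (degS : ℕ), 0 < degS ∧
        padicValNat 3 degS = padicValNat 3 P₀.deg ∧
        LDerivEK W K =
          8 * (Real.pi : ℂ) ^ 2 * peterssonProduct (Gamma0 N) 2 Dt.f Dt.f /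
              ((((Units.torsionOrder K : ℝ) / 2) ^ 2 * √|(NumberField.discr K : ℝ)| : ℝ) : ℂ) *
            ((P.canonicalHeight : ℂ) / (degS : ℂ)) ∧
        (¬ IsOfFinAddOrder P →
          Nat.card (AddCommGroup.primaryComponent (W.baseChange K).sha 3) ≤
            3 ^ (2 * padicValNat 3 (AddSubgroup.zmultiples P).index)))
    -- the partner's LOWER half at this field
    (hPL : ∀ (Wd : WeierstrassCurve ℚ) [Wd.IsElliptic] [Wd.IsGloballyMinimal] (Cd : VariableChange ℚ),
      Cd • W.quadraticTwist (NumberField.discr K : ℚ) = Wd → Typed.MissingLowerBoundAt Wd 3) :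
    Typed.MissingUpperBoundAt W 3 := by
  subst hN
  haveI h3F : Fact (Nat.Prime 3) := ⟨Nat.prime_three⟩
  have hNS : integral_neronScaling_of_isGloballyMinimal :=
    integral_neronScaling_of_isGloballyMinimal_holds
  have hp : (3 : ℕ).Prime := Nat.prime_three
  have hp2 : (3 : ℕ) ≠ 2 := by decide
  have hirr : W.HasIrreducibleModPGaloisRep 3 := Additive.irr_of_subGss_of_ne_two W 3 hp2 hadd hsub
  have hbad3 : ¬ W.HasGoodReductionAtPrime 3 := not_good_of_addv W 3 hadd
  have hnm3 : ¬ W.HasMultiplicativeReductionAtPrime 3 := not_mult_of_addv W 3 hadd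
  have hN0 : W.conductorNorm ℤ ≠ 0 := (W.conductorNorm_pos_holds).ne'
  haveI : NeZero (W.conductorNorm ℤ) := ⟨hN0⟩
  have hNpos : 0 < W.conductorNorm ℤ := W.conductorNorm_pos_holds
  -- the set of multiplicative primes and the Pasten package with (P618)
  set Mlt : Finset ℕ := (W.conductorNorm ℤ).primeFactors.filter
    (fun q ↦ ∃ h : q.Prime, @WeierstrassCurve.HasMultiplicativeReductionAtPrime W q ⟨h⟩) with hMlt
  have hmemMlt : ∀ {q : ℕ} [hq : Fact q.Prime], W.HasMultiplicativeReductionAtPrime q → q ∈ Mlt := by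
    intro q hq hm
    have hqN : q ∣ W.conductorNorm ℤ :=
      (W.dvd_conductorNorm_iff_not_hasGoodReductionAtPrime q).mpr
        (WeierstrassCurve.HasMultiplicativeReduction.not_hasGoodReduction (R := ℤ_[q]) hm)
    exact Finset.mem_filter.mpr ⟨Nat.mem_primeFactors.mpr ⟨hq.out, hqN, hN0⟩, hq.out, hm⟩
  -- the optimal classical datum of the class (Modularity) and the Pasten package (named facts)
  obtain ⟨W₀, hW₀, hW₀m, D₀, hfW, hisoW, hmin⟩ :=
    exists_optimal_modularParametrizationData_of_modularity hnf (W.conductorNorm ℤ) W rfl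
  obtain ⟨δ, cA, ι, κ, hδ0, hδ, hcA, hanchor, h613, hij, h68, hEis, h618⟩ :=
    ribetTakahashiPackageCokerTwo_of_componentOrders hCO PastenShimura2024_lemma_6_8_isogeny_holds hJL W 3 hirr
      (W.conductorNorm ℤ) W₀ D₀ rfl hfW hmin
  obtain ⟨hvA, hι⟩ := rtPackage_valuation_forms W 3 hirr hcA h68 hEis
  -- the inert set sits inside the multiplicative primes and avoids `3`
  have hSMlt : S ⊆ Mlt := by
    intro ℓ hℓ
    obtain ⟨hℓF, hm⟩ := hSmult ℓ hℓ
    exact @hmemMlt ℓ hℓF hm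
  have hpS : 3 ∉ S := by
    intro h
    obtain ⟨_, hm⟩ := hSmult 3 h
    exact hnm3 hm
  -- (DEG) from one of the three printed mechanisms (the third: the FULL Papikian–Rabinoff pairing)
  have hdeg : padicValNat 3 (δ ∅) =
      padicValNat 3 (δ S) + ∑ x ∈ S, padicValNat 3 (padicValInt x W.minimalDiscriminantInt) := by
    rcases hDEG with ⟨ℓ₀, hℓ₀S, hram₀⟩ | ⟨ℓ₀, t, hℓ₀F, htF, hm₀, hmt, hℓ₀S, htS, htℓ, hram₀⟩ |
        ⟨R, hRS, hRcard, hR⟩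
    · obtain ⟨n, hn⟩ := hSeven
      exact RTDegree.padicValNat_delta_empty_eq_of_witness_mem h613 hδ hcA hij hvA hι
        (padicValNat.eq_zero_of_not_dvd hram₀) n S hSMlt (by omega) (Or.inr hℓ₀S)
    · haveI := hℓ₀F; haveI := htF
      exact RTDegree.padicValNat_delta_empty_eq_of_witness h613 hδ hcA hij hvA hι hSMlt hSeven
        (hmemMlt hm₀) (padicValNat.eq_zero_of_not_dvd hram₀) (hmemMlt hmt) htS htℓ
    · exact padicValNat_delta_empty_eq_of_pairingTwo (c := fun x ↦ padicValInt x W.minimalDiscriminantInt)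
        h613 hδ hcA hij hvA hι h618 hp2 R.card S R hSMlt hRS (by omega) rfl hR
  -- field data
  have h2 := hK.1
  have hd4 : NumberField.discr K % 4 = 1 := discr_emod_four_eq_one hK.1 hodd
  have h3N : 3 ∣ W.conductorNorm ℤ := (W.dvd_conductorNorm_iff_not_hasGoodReductionAtPrime 3).mpr hbad3
  have hps2 : ((Ideal.span {((3 : ℕ) : ℤ)}).primesOver (𝓞 K)).ncard = 2 := hsplitN 3 hp h3N hpS
  have hps : SplitsIn K 3 := hps2
  have hH3 : SatisfiesHeegnerHypothesis 3 K := fun q hq hq3 ↦ by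
    have : q = 3 := (Nat.prime_dvd_prime_iff_eq hq hp).mp hq3
    subst this; exact hps2
  have hpd : ¬ ((3 : ℕ) : ℤ) ∣ NumberField.discr K := not_dvd_discr_of_splitsIn h2 hp hps
  -- `d_K < -4` (odd, `≠ -3`), so `w_K = 2` is prime to `3`
  have hμ : ¬ 3 ∣ Units.torsionOrder K := by
    haveI : IsTotallyComplex K := hK.2
    have hneg : NumberField.discr K < 0 := discr_neg_of_finrank_eq_two K hK.1
    have h3d : NumberField.discr K ≠ -3 := by
      intro h; apply hpd; rw [h]; norm_num
    have h4 : NumberField.discr K < -4 := by omega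
    rw [Literature.NumberTheory.DiophantineGeometry.torsionOrder_eq_two_of_discr_lt hK.1 h4]
    decide
  have hSin : ∀ ℓ ∈ S, ∃ _ : Fact ℓ.Prime, Mult W ℓ ∧
      ((ℓ ≠ 2 ∧ jacobiSym (NumberField.discr K) ℓ = -1) ∨ (ℓ = 2 ∧ NumberField.discr K % 8 = 5)) := by
    intro ℓ hℓ
    obtain ⟨hℓF, hm⟩ := hSmult ℓ hℓ
    obtain ⟨hn, hd⟩ := hinert ℓ hℓ
    refine ⟨hℓF, hm, ?_⟩
    have hn' : ((Ideal.span {(ℓ : ℤ)}).primesOver (𝓞 K)).ncard ≠ 2 := by rw [hn]; decide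
    by_cases hℓ2 : ℓ = 2
    · subst hℓ2
      have hn2 : ((Ideal.span {(2 : ℤ)}).primesOver (𝓞 K)).ncard ≠ 2 := by
        simpa only [Nat.cast_ofNat] using hn'
      have hd2 : ¬ (2 : ℤ) ∣ NumberField.discr K := by simpa only [Nat.cast_ofNat] using hd
      exact Or.inr ⟨rfl, discr_emod_eight_eq_five_of_ncard_ne_two h2 hn2 hd2⟩
    · exact Or.inl ⟨hℓ2, jacobiSym_discr_eq_neg_one_of_ncard_ne_two h2 hℓF.out hℓ2 hn' hd⟩
  have hsplit : ∀ (ℓ : ℕ) [Fact ℓ.Prime], ¬ W.HasGoodReductionAtPrime ℓ → ℓ ∉ S →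
      IsSquare (algebraMap ℚ ℚ_[ℓ] (NumberField.discr K : ℚ)) := by
    intro ℓ hℓF hg hℓS
    have hℓN : ℓ ∣ W.conductorNorm ℤ := (W.dvd_conductorNorm_iff_not_hasGoodReductionAtPrime ℓ).mpr hg
    exact isSquare_discr_padic_of_ncard_eq_two h2 ℓ (hsplitN ℓ hℓF.out hℓN hℓS)
  -- `d_K` odd: the ramified primes of `K` are good primes `≥ 5` (`2 ∤ d_K`, `3 ∤ d_K`)
  have hdodd : ¬ (2 : ℤ) ∣ NumberField.discr K := by
    obtain ⟨k, hk⟩ := hodd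
    omega
  have h5 : ∀ (q : ℕ) [Fact q.Prime], (q : ℤ) ∣ NumberField.discr K → W.HasGoodReductionAtPrime q →
      5 ≤ q ∨ 5 ≤ 3 := by
    intro q hqF hqd _
    have hq : q.Prime := hqF.out
    have hq2 : q ≠ 2 := by
      rintro rfl
      exact hdodd (by exact_mod_cast hqd)
    have hq3 : q ≠ 3 := by
      rintro rfl
      exact hpd hqd
    exact Or.inl (hq.five_le_of_ne_two_of_ne_three hq2 hq3)
  -- a globally minimal model of the twist (a rank-ONE leaf curve), differing from the twisted equation by a `3`-unit
  have hD0 : (NumberField.discr K : ℚ) ≠ 0 := by exact_mod_cast NumberField.discr_ne_zero K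
  haveI hEt : (W.quadraticTwist (NumberField.discr K : ℚ)).IsElliptic :=
    W.isElliptic_quadraticTwist hD0
  obtain ⟨Cd, hCd⟩ := hasGlobalMinimalModel_rat_holds (W.quadraticTwist (NumberField.discr K : ℚ))
  haveI : (Cd • W.quadraticTwist (NumberField.discr K : ℚ)).IsGloballyMinimal := hCd
  set Wd : WeierstrassCurve ℚ := Cd • W.quadraticTwist (NumberField.discr K : ℚ) with hWd_def
  have hWd : Cd • W.quadraticTwist (NumberField.discr K : ℚ) = Wd := rfl
  have hu : padicValRat 3 (Cd.u : ℚ) = 0 :=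
    padicValRat_u_eq_zero_of_twist_minimal_of_splitsIn W 3 K h2 hps Cd hWd
  have hrt : (W.quadraticTwist (NumberField.discr K : ℚ)).analyticRank = 1 :=
    analyticRank_eq_one_of_entireLFunction_one_eq_zero_of_deriv_ne_zero _ (hmod _) hLt0 hLt1
  have hrd : Wd.analyticRank = 1 := by rw [← hWd, analyticRank_smul, hrt]
  -- the partner's lower half gives a RATIONAL `q_d = L′(Wd,1)/(Reg·Ω)` with `ord₃ q_d ≤ ord₃ #Ш(Wd) + ord₃ ∏c(Wd) − 2 ord₃ t_d`
  obtain ⟨q', hq', hq'le⟩ := hPL Wd Cd hWd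
  have hΩd : (Wd.realPeriodRat : ℂ) ≠ 0 := by exact_mod_cast Wd.realPeriodRat_pos_holds.ne'
  have hcd : (Wd.tamagawaProduct : ℂ) ≠ 0 := by exact_mod_cast Wd.tamagawaProduct_pos_holds.ne'
  have hRd : (Wd.regulator : ℂ) ≠ 0 := by exact_mod_cast Wd.regulator_pos'.ne'
  have htd0 : (Wd.torsionOrder : ℂ) ≠ 0 := by exact_mod_cast Wd.torsionOrder_pos_holds.ne'
  set qd : ℚ := q' * (Wd.tamagawaProduct : ℚ) / (Wd.torsionOrder : ℚ) ^ 2 with hqd_def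
  have hqd : Wd.leadingLCoeff = (((qd : ℝ) * Wd.regulator * Wd.realPeriodRat : ℝ) : ℂ) := by
    have h1 : Wd.leadingLCoeff = (q' : ℂ) * ((Wd.realPeriodRat : ℂ) * (Wd.tamagawaProduct : ℂ) *
        (Wd.regulator : ℂ)) / (Wd.torsionOrder : ℂ) ^ 2 := by
      rw [shaAn_def] at hq'
      field_simp at hq'
      field_simp
      linear_combination hq'
    rw [h1, hqd_def]
    push_cast
    field_simp
  ---------------------------------------------------------------- the Shimura curve `X_{N⁺,N⁻}`, `N⁻ = ∏ S`, and its class-minimal datum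
  obtain ⟨X, W', hW', P₀, hP₀, hdegδ⟩ := hanchor hSMlt hSeven
  haveI := hW'
  obtain ⟨P, degS, hdegS, hlinkS, hGZP, hUShP⟩ := hHKat X W' P₀ hP₀
  -- the two degree links
  have hlink₁ : padicValNat 3 Dt.modularDegree = padicValNat 3 (δ ∅) := by
    rw [hδ0]; exact padicValNat_modularDegree_eq_of_isNewformOf hNS hisoW D₀ hfW hmin hp hirr Dt hc
  have hlink₂ : padicValNat 3 degS = padicValNat 3 (δ S) := by rw [hlinkS, hdegδ]
  ---------------------------------------------------------------- the `ρ`-Gross–Zagier identity, `ρ = deg φ_{Dt}/degS`, `ord₃ ρ = Σ_S ord₃ ord_qΔ`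
  have hGZR := degS_mul_lDerivEK_eq_of_petersson W (W.conductorNorm ℤ) K Dt P hdegS hGZP
  set ρ : ℚ := (Dt.modularDegree : ℚ) / (degS : ℚ) with hρ_def
  have hDtpos : 0 < Dt.modularDegree := Dt.deg_pos
  have hρ0 : 0 < ρ := div_pos (by exact_mod_cast hDtpos) (by exact_mod_cast hdegS)
  have hρ : padicValRat 3 ρ = (∑ x ∈ S, padicValNat 3 (padicValInt x W.minimalDiscriminantInt) : ℕ) := by
    rw [hρ_def, padicValRat.div (by exact_mod_cast hDtpos.ne') (by exact_mod_cast hdegS.ne'),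
      padicValRat.of_nat, padicValRat.of_nat, hlink₁, hlink₂, hdeg]
    push_cast
    ring
  have hLD : LDerivEK W K = (((ρ : ℝ) * grossZagierConstant Dt K * P.canonicalHeight : ℝ) : ℂ) := by
    have hdegS0 : (degS : ℂ) ≠ 0 := by exact_mod_cast hdegS.ne'
    have key : LDerivEK W K = ((2 * ZLattice.covolume Dt.L.lattice * (Dt.modularDegree : ℝ) /
          ((Dt.c : ℝ) ^ 2 * ((Units.torsionOrder K : ℝ) / 2) ^ 2 * √|(NumberField.discr K : ℝ)|) *
        P.canonicalHeight : ℝ) : ℂ) / (degS : ℂ) := by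
      rw [← hGZR, mul_div_cancel_left₀ _ hdegS0]
    rw [key, hρ_def]
    unfold grossZagierConstant
    push_cast
    field_simp
  ---------------------------------------------------------------- the rank-zero bookkeeping (bsd-print-x6, rational factor of any valuation)
  obtain ⟨hfinW, hfinSd, -, hPinf, q, hshaAn, hval⟩ :=
    exists_shaAn_padicVal_eq_of_gzIdentity_rankZero_ratFactorVal W 3 (W.conductorNorm ℤ) K Dt P hGZK hmod hK hp2 hc hμ hr
      Wd Cd hWd hu hrd qd hqd ρ hρ0 hLD
  have hUSh := hUShP hPinf
  ---------------------------------------------------------------- `Ш(E/K)[3^∞] = Ш(E)[3^∞] ⊕ Ш(E^d)[3^∞]`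
  haveI : (W.baseChange K).IsElliptic := inferInstanceAs (W.map (algebraMap ℚ K)).IsElliptic
  haveI : Finite W.sha := hfinW
  haveI : Finite Wd.sha := hfinSd
  haveI : Finite (AddCommGroup.primaryComponent W.sha 3) := Finite.of_injective _ Subtype.val_injective
  haveI : Finite (AddCommGroup.primaryComponent Wd.sha 3) := Finite.of_injective _ Subtype.val_injective
  have hprod := card_primaryComponent_sha_baseChange_quadratic_of_odd_of_finite W K h2 Wd ⟨Cd, hWd⟩
    (W.baseChange K) ⟨1, one_smul _ _⟩ 3 hp2
  rw [card_addPrimaryComponent_eq_pow (A := ↥W.sha) 3, card_addPrimaryComponent_eq_pow (A := ↥Wd.sha) 3,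
    ← pow_add, Nat.factorization_def _ hp, Nat.factorization_def _ hp] at hprod
  rw [hprod] at hUSh
  have e1 : padicValNat 3 (Nat.card W.sha) + padicValNat 3 (Nat.card Wd.sha) ≤
      2 * padicValNat 3 (AddSubgroup.zmultiples P).index :=
    (Nat.pow_le_pow_iff_right hp.one_lt).mp hUSh
  ---------------------------------------------------------------- the numeric Tamagawa condition, the partner's lower half, conclusion
  have hT := padicValNat_tamagawaProduct_add_twist_le_of_inertSet'_odd W 3 hp2 K h2 hdodd h5 hshape Cd hWd S
    hSin (fun ℓ _ hg hℓS ↦ hsplit ℓ hg hℓS) (fun ℓ _ hℓS hs ↦ hFC ℓ hℓS hs)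
  have hq'0 : q' ≠ 0 := by
    intro h0
    apply Wd.leadingLCoeff_ne_zero_holds (hmod Wd)
    rw [hqd, hqd_def, h0]
    simp
  have hvqd : padicValRat 3 qd = padicValRat 3 q' + padicValNat 3 Wd.tamagawaProduct -
      2 * padicValNat 3 Wd.torsionOrder := by
    have ht' : (Wd.torsionOrder : ℚ) ≠ 0 := by exact_mod_cast Wd.torsionOrder_pos_holds.ne'
    have hc' : (Wd.tamagawaProduct : ℚ) ≠ 0 := by exact_mod_cast Wd.tamagawaProduct_pos_holds.ne'
    rw [hqd_def, padicValRat.div (mul_ne_zero hq'0 hc') (pow_ne_zero 2 ht'), padicValRat.mul hq'0 hc',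
      padicValRat.pow, padicValRat.of_nat, padicValRat.of_nat]
    ring
  refine ⟨q, hshaAn, ?_⟩
  have e1' : (padicValNat 3 W.shaOrder : ℤ) + padicValNat 3 Wd.shaOrder ≤
      2 * padicValNat 3 (AddSubgroup.zmultiples P).index := by
    unfold WeierstrassCurve.shaOrder; exact_mod_cast e1
  have e4 : (padicValNat 3 W.tamagawaProduct : ℤ) + padicValNat 3 Wd.tamagawaProduct ≤
      (∑ x ∈ S, padicValNat 3 (padicValInt x W.minimalDiscriminantInt) : ℕ) := by exact_mod_cast hT
  have e5 : padicValRat 3 q' ≤ (padicValNat 3 Wd.shaOrder : ℤ) := hq'le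
  rw [hρ, hvqd] at hval
  omega

end Summit.BirchSwinnertonDyer.BirchSwinnertonDyer.Theorems.LeafShimuraInert

end
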